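import Summits.Ventures.PercRepro.SingleMergeMeets

/-!
# Four good pairs with at least two open edges: `|S| + 5 ≤ topBotCount`

`card_add_one_le_topBotCount` (SingleMergeDim) counts the `|S| + 1` good pairs `{∅, ⊤}` and
`{{e}, {e}ᶜ}` of a three-type single-merge map. The cyclic meet lemma (SingleMergeMeets) gives, for
a cyclic triple `A ∈ T₁₂, B ∈ T₂₃, C ∈ T₃₁`, six further good `⊥`-members with at least two open
edges: `A ⊓ B, B ⊓ C, C ⊓ A` and `Aᶜ ⊓ Bᶜ, Bᶜ ⊓ Cᶜ, Cᶜ ⊓ Aᶜ`. They are never all equal: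

* a `P`-meet and a `Q`-meet are disjoint nonempty sets, hence distinct;
* `A ⊓ B = C ⊓ B` and `Aᶜ ⊓ Bᶜ = Cᶜ ⊓ Bᶜ` would force `A = C` (agreement inside and outside `B`),
  against `c A = x₁ ≠ x₃ = c C`; likewise for the other two cyclic positions.

A short case analysis (`four_distinct_meets`) therefore always finds FOUR pairwise distinct ones,
and with the `|S| + 1` trivial pairs (all of which have `≤ 1` open edge on the `⊥` side)
`|S| + 5 ≤ topBotCount c`. This is the `b = 3` case of the doubling count «good sets of size ≥ 2
are at least `2(b − 1)`» (proofs/P4-gen7.md §6), and it is sharp: the `d = 8` block lift has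
`b = 3` and exactly `13 = 8 + 5` good pairs.
-/

namespace PercRepro

open Finset

section Boolean

variable {S : Type}

/-- Two configurations that agree inside `B` and outside `B` are equal. -/
theorem eq_of_inf_eq_of_compl_inf_eq {A B C : Config S} (h1 : A ⊓ B = C ⊓ B)
    (h2 : Aᶜ ⊓ Bᶜ = Cᶜ ⊓ Bᶜ) : A = C := by
  funext e
  have e1 := congrFun h1 e
  have e2 := congrFun h2 e
  simp only [Pi.inf_apply, Pi.compl_apply] at e1 e2
  cases hA : A e <;> cases hB : B e <;> cases hC : C e <;> simp_all

/-- A set below `X` and a set below `Xᶜ` meet in `⊥`. -/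
theorem inf_eq_bot_of_le_of_le_compl {P Q X : Config S} (hP : P ≤ X) (hQ : Q ≤ Xᶜ) :
    P ⊓ Q = ⊥ :=
  le_bot_iff.1 (le_trans (inf_le_inf hP hQ) (le_of_eq inf_compl_eq_bot))

/-- A nonzero set below `X` differs from every set below `Xᶜ`. -/
theorem ne_of_le_of_le_compl {P Q X : Config S} (hP : P ≤ X) (hQ : Q ≤ Xᶜ) (h0 : P ≠ ⊥) :
    P ≠ Q := by
  intro h
  apply h0
  have := inf_eq_bot_of_le_of_le_compl hP hQ
  rwa [← h, inf_idem] at this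

end Boolean

section Four

variable {S : Type} [Fintype S] [DecidableEq S]

omit [DecidableEq S] in
/-- A set with at least two open edges is not `⊥`. -/
theorem ne_bot_of_two_le_card_openEdges {ω : Config S} (h : 2 ≤ (openEdges ω).card) : ω ≠ ⊥ := by
  rintro rfl
  have : openEdges (⊥ : Config S) = ∅ := by
    ext e; simp [openEdges]
  rw [this, Finset.card_empty] at h
  omega

/-- The size of a four-element finset given by pairwise distinct elements. -/
theorem card_four_of_ne {α : Type} [DecidableEq α] {a b c d : α} (hab : a ≠ b) (hac : a ≠ c)
    (had : a ≠ d) (hbc : b ≠ c) (hbd : b ≠ d) (hcd : c ≠ d) :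
    ({a, b, c, d} : Finset α).card = 4 := by
  rw [Finset.card_insert_of_notMem, Finset.card_insert_of_notMem, Finset.card_insert_of_notMem,
    Finset.card_singleton]
  · simp [hcd]
  · simp [hbc, hbd]
  · simp [hab, hac, had]

/-- **Four distinct cyclic meets.** For a cyclic triple `A ∈ T₁₂, B ∈ T₂₃, C ∈ T₃₁` of a monotone
single-merge map, four of the six meets `A ⊓ B, B ⊓ C, C ⊓ A, Aᶜ ⊓ Bᶜ, Bᶜ ⊓ Cᶜ, Cᶜ ⊓ Aᶜ` are
pairwise distinct; all six are good with at least two open edges. -/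
theorem four_distinct_meets (c : Config S → Setoid (Fin 4)) (hc : Monotone c)
    (hsm : SingleMergeMap c) {A B C : Config S}
    (hA : c A = cross4 0) (hAc : c Aᶜ = cross4 1) (hB : c B = cross4 1) (hBc : c Bᶜ = cross4 2)
    (hC : c C = cross4 2) (hCc : c Cᶜ = cross4 0) :
    ∃ W : Finset (Config S), W.card = 4 ∧
      ∀ w ∈ W, c w = ⊥ ∧ c wᶜ = ⊤ ∧ 2 ≤ (openEdges w).card := by
  -- the six meets are good with ≥ 2 open edges
  have hP1 := cyclic_meet c hc hsm (i := 0) (j := 1) (k := 2) (by decide) (by decide) (by decide)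
    hA hAc hB hBc
  have hP2 := cyclic_meet c hc hsm (i := 1) (j := 2) (k := 0) (by decide) (by decide) (by decide)
    hB hBc hC hCc
  have hP3 := cyclic_meet c hc hsm (i := 2) (j := 0) (k := 1) (by decide) (by decide) (by decide)
    hC hCc hA hAc
  have hQ1' := cyclic_meet c hc hsm (i := 2) (j := 1) (k := 0) (by decide) (by decide) (by decide)
    hBc (by rw [compl_compl]; exact hB) hAc (by rw [compl_compl]; exact hA)
  have hQ2' := cyclic_meet c hc hsm (i := 0) (j := 2) (k := 1) (by decide) (by decide) (by decide)
    hCc (by rw [compl_compl]; exact hC) hBc (by rw [compl_compl]; exact hB)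
  have hQ3' := cyclic_meet c hc hsm (i := 1) (j := 0) (k := 2) (by decide) (by decide) (by decide)
    hAc (by rw [compl_compl]; exact hA) hCc (by rw [compl_compl]; exact hC)
  have hQ1 : c (Aᶜ ⊓ Bᶜ) = ⊥ ∧ c (Aᶜ ⊓ Bᶜ)ᶜ = ⊤ ∧ 2 ≤ (openEdges (Aᶜ ⊓ Bᶜ)).card := by
    rwa [inf_comm] at hQ1'
  have hQ2 : c (Bᶜ ⊓ Cᶜ) = ⊥ ∧ c (Bᶜ ⊓ Cᶜ)ᶜ = ⊤ ∧ 2 ≤ (openEdges (Bᶜ ⊓ Cᶜ)).card := by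
    rwa [inf_comm] at hQ2'
  have hQ3 : c (Cᶜ ⊓ Aᶜ) = ⊥ ∧ c (Cᶜ ⊓ Aᶜ)ᶜ = ⊤ ∧ 2 ≤ (openEdges (Cᶜ ⊓ Aᶜ)).card := by
    rwa [inf_comm] at hQ3'
  -- nonzero
  have n1 := ne_bot_of_two_le_card_openEdges hP1.2.2
  have n2 := ne_bot_of_two_le_card_openEdges hP2.2.2
  have n3 := ne_bot_of_two_le_card_openEdges hP3.2.2
  -- a P-meet never equals a Q-meet
  have pq11 : A ⊓ B ≠ Aᶜ ⊓ Bᶜ := ne_of_le_of_le_compl inf_le_left inf_le_left n1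
  have pq12 : A ⊓ B ≠ Bᶜ ⊓ Cᶜ := ne_of_le_of_le_compl inf_le_right inf_le_left n1
  have pq13 : A ⊓ B ≠ Cᶜ ⊓ Aᶜ := ne_of_le_of_le_compl inf_le_left inf_le_right n1
  have pq21 : B ⊓ C ≠ Aᶜ ⊓ Bᶜ := ne_of_le_of_le_compl inf_le_left inf_le_right n2
  have pq22 : B ⊓ C ≠ Bᶜ ⊓ Cᶜ := ne_of_le_of_le_compl inf_le_left inf_le_left n2
  have pq23 : B ⊓ C ≠ Cᶜ ⊓ Aᶜ := ne_of_le_of_le_compl inf_le_right inf_le_left n2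
  have pq31 : C ⊓ A ≠ Aᶜ ⊓ Bᶜ := ne_of_le_of_le_compl inf_le_right inf_le_left n3
  have pq32 : C ⊓ A ≠ Bᶜ ⊓ Cᶜ := ne_of_le_of_le_compl inf_le_left inf_le_right n3
  have pq33 : C ⊓ A ≠ Cᶜ ⊓ Aᶜ := ne_of_le_of_le_compl inf_le_left inf_le_left n3
  -- the cells of A, B, C are pairwise distinct
  have hAC : A ≠ C := fun h => by
    have := hA; rw [h, hC] at this; exact absurd (cross4_injective this) (by decide)
  have hAB : A ≠ B := fun h => by
    have := hA; rw [h, hB] at this; exact absurd (cross4_injective this) (by decide)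
  have hBC : B ≠ C := fun h => by
    have := hB; rw [h, hC] at this; exact absurd (cross4_injective this) (by decide)
  -- the three exclusions
  have ex1 : ¬ (A ⊓ B = B ⊓ C ∧ Aᶜ ⊓ Bᶜ = Bᶜ ⊓ Cᶜ) := by
    rintro ⟨h1, h2⟩
    apply hAC
    exact eq_of_inf_eq_of_compl_inf_eq (B := B) (by rw [h1, inf_comm]) (by rw [h2, inf_comm])
  have ex2 : ¬ (B ⊓ C = C ⊓ A ∧ Bᶜ ⊓ Cᶜ = Cᶜ ⊓ Aᶜ) := by
    rintro ⟨h1, h2⟩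
    apply hAB
    exact (eq_of_inf_eq_of_compl_inf_eq (B := C) (by rw [h1, inf_comm]) (by rw [h2, inf_comm])).symm
  have ex3 : ¬ (C ⊓ A = A ⊓ B ∧ Cᶜ ⊓ Aᶜ = Aᶜ ⊓ Bᶜ) := by
    rintro ⟨h1, h2⟩
    apply hBC
    exact (eq_of_inf_eq_of_compl_inf_eq (B := A) (by rw [h1, inf_comm]) (by rw [h2, inf_comm])).symm
  -- the case analysis
  by_cases p12 : A ⊓ B = B ⊓ C
  · have q12 : Aᶜ ⊓ Bᶜ ≠ Bᶜ ⊓ Cᶜ := fun h => ex1 ⟨p12, h⟩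
    by_cases p23 : B ⊓ C = C ⊓ A
    · have q23 : Bᶜ ⊓ Cᶜ ≠ Cᶜ ⊓ Aᶜ := fun h => ex2 ⟨p23, h⟩
      have q31 : Cᶜ ⊓ Aᶜ ≠ Aᶜ ⊓ Bᶜ := fun h => ex3 ⟨p23.symm.trans p12.symm, h⟩
      refine ⟨{A ⊓ B, Aᶜ ⊓ Bᶜ, Bᶜ ⊓ Cᶜ, Cᶜ ⊓ Aᶜ},
        card_four_of_ne pq11 pq12 pq13 q12 (Ne.symm q31) q23, ?_⟩
      intro w hw
      simp only [Finset.mem_insert, Finset.mem_singleton] at hw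
      rcases hw with rfl | rfl | rfl | rfl
      exacts [hP1, hQ1, hQ2, hQ3]
    · refine ⟨{A ⊓ B, C ⊓ A, Aᶜ ⊓ Bᶜ, Bᶜ ⊓ Cᶜ},
        card_four_of_ne (p12.trans_ne p23) pq11 pq12 pq31 pq32 q12, ?_⟩
      intro w hw
      simp only [Finset.mem_insert, Finset.mem_singleton] at hw
      rcases hw with rfl | rfl | rfl | rfl
      exacts [hP1, hP3, hQ1, hQ2]
  · by_cases q12 : Aᶜ ⊓ Bᶜ = Bᶜ ⊓ Cᶜ
    · by_cases q23 : Bᶜ ⊓ Cᶜ = Cᶜ ⊓ Aᶜ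
      · have p23 : B ⊓ C ≠ C ⊓ A := fun h => ex2 ⟨h, q23⟩
        have p31 : C ⊓ A ≠ A ⊓ B := fun h => ex3 ⟨h, q23.symm.trans q12.symm⟩
        refine ⟨{A ⊓ B, B ⊓ C, C ⊓ A, Aᶜ ⊓ Bᶜ},
          card_four_of_ne p12 (Ne.symm p31) pq11 p23 pq21 pq31, ?_⟩
        intro w hw
        simp only [Finset.mem_insert, Finset.mem_singleton] at hw
        rcases hw with rfl | rfl | rfl | rfl
        exacts [hP1, hP2, hP3, hQ1]
      · refine ⟨{A ⊓ B, B ⊓ C, Bᶜ ⊓ Cᶜ, Cᶜ ⊓ Aᶜ},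
          card_four_of_ne p12 pq12 pq13 pq22 pq23 q23, ?_⟩
        intro w hw
        simp only [Finset.mem_insert, Finset.mem_singleton] at hw
        rcases hw with rfl | rfl | rfl | rfl
        exacts [hP1, hP2, hQ2, hQ3]
    · refine ⟨{A ⊓ B, B ⊓ C, Aᶜ ⊓ Bᶜ, Bᶜ ⊓ Cᶜ},
        card_four_of_ne p12 pq11 pq12 pq21 pq22 q12, ?_⟩
      intro w hw
      simp only [Finset.mem_insert, Finset.mem_singleton] at hw
      rcases hw with rfl | rfl | rfl | rfl
      exacts [hP1, hP2, hQ1, hQ2]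

/-- **`|S| + 5` good pairs**: the `|S| + 1` trivial pairs (`card_add_one_le_topBotCount`) and four
pairwise distinct cyclic meets with at least two open edges. -/
theorem card_add_five_le_topBotCount (c : Config S → Setoid (Fin 4)) (hc : Monotone c)
    (hsm : SingleMergeMap c) (h3 : ThreeTypes c) :
    Fintype.card S + 5 ≤ topBotCount c := by
  classical
  obtain ⟨A, hA, hAc⟩ := h3 0 1 (by decide)
  obtain ⟨B, hB, hBc⟩ := h3 1 2 (by decide)
  obtain ⟨C, hC, hCc⟩ := h3 2 0 (by decide)
  obtain ⟨W, hWcard, hW⟩ := four_distinct_meets c hc hsm hA hAc hB hBc hC hCc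
  rw [topBotCount_eq_card_goodSet]
  -- the trivial family: `⊤` and the co-singletons
  set T : Finset (Config S) := insert ⊤ (Finset.univ.image fun e : S => (singleConfig e)ᶜ) with hT
  have hTsub : T ⊆ goodSet c := by
    intro ω hω
    rw [hT, Finset.mem_insert, Finset.mem_image] at hω
    unfold goodSet
    rw [Finset.mem_filter]
    refine ⟨Finset.mem_univ _, ?_⟩
    rcases hω with rfl | ⟨e, -, rfl⟩
    · refine ⟨?_, ?_⟩
      · apply top_le_iff.1
        calc (⊤ : Setoid (Fin 4)) = cross4 0 ⊔ cross4 1 := (cross4_sup_eq_top (by decide)).symm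
          _ = c A ⊔ c Aᶜ := by rw [hA, hAc]
          _ ≤ c ⊤ := sup_le (hc le_top) (hc le_top)
      · rw [compl_top]; exact cell_bot_eq_bot c hc h3
    · refine ⟨cell_compl_singleConfig_eq_top c hc h3 e, ?_⟩
      rw [compl_compl]; exact cell_singleConfig_eq_bot c hc hsm h3 e
  have hTcard : T.card = Fintype.card S + 1 := by
    rw [hT, Finset.card_insert_of_notMem, Finset.card_image_of_injective _ compl_singleConfig_injective,
      Finset.card_univ]
    rw [Finset.mem_image]
    rintro ⟨e, -, he⟩
    exact compl_singleConfig_ne_top e he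
  -- the complements of the four meets
  set W' : Finset (Config S) := W.image compl with hW'
  have hW'sub : W' ⊆ goodSet c := by
    intro ω hω
    rw [hW', Finset.mem_image] at hω
    obtain ⟨w, hw, rfl⟩ := hω
    obtain ⟨h1, h2, -⟩ := hW w hw
    unfold goodSet
    rw [Finset.mem_filter]
    exact ⟨Finset.mem_univ _, h2, by rw [compl_compl]; exact h1⟩
  have hW'card : W'.card = 4 := by
    rw [hW', Finset.card_image_of_injective _ compl_injective, hWcard]
  -- every member of `T` has at least `|S| − 1` open edges, every member of `W'` at most `|S| − 2`
  have hTbig : ∀ ω ∈ T, Fintype.card S ≤ (openEdges ω).card + 1 := by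
    intro ω hω
    rw [hT, Finset.mem_insert, Finset.mem_image] at hω
    rcases hω with rfl | ⟨e, -, rfl⟩
    · have : openEdges (⊤ : Config S) = Finset.univ := by ext x; simp [openEdges]
      rw [this, Finset.card_univ]; omega
    · rw [openEdges_compl, Finset.card_compl]
      have : openEdges (singleConfig e) = {e} := by
        ext x; simp [openEdges, singleConfig]
      rw [this, Finset.card_singleton]
      have := Fintype.card_pos_iff.2 ⟨e⟩
      omega
  have hW'small : ∀ ω ∈ W', (openEdges ω).card + 2 ≤ Fintype.card S := by
    intro ω hω
    rw [hW', Finset.mem_image] at hω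
    obtain ⟨w, hw, rfl⟩ := hω
    obtain ⟨-, -, h2⟩ := hW w hw
    rw [openEdges_compl, Finset.card_compl]
    have := Finset.card_le_univ (openEdges w)
    omega
  have hdisj : Disjoint T W' := by
    rw [Finset.disjoint_left]
    intro ω h1 h2
    have := hTbig ω h1
    have := hW'small ω h2
    omega
  calc Fintype.card S + 5 = T.card + W'.card := by rw [hTcard, hW'card]
    _ = (T ∪ W').card := (Finset.card_union_of_disjoint hdisj).symm
    _ ≤ (goodSet c).card := Finset.card_le_card (Finset.union_subset hTsub hW'sub)

end Four

end PercRepro
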